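/-
Copyright (c) 2026 the pub-hodgecm-mathlib formalisation cell (harness21).  Prover seat hodgecm-mathlib-F0P3b-p01 (g17): line LH3 (closer stub `stub_N9`), LETTER L1 clause (I₁),
brick (H-core) of LH5-p02 (g4)'s «THREE HANDS» plan (2026-09-02T10:57:48Z), layer L2 «(A5a′) `w₀` HELD OUT», part 1 (the `chartOrbG` half; an edition of ★ (A1) §3–§4).
-/
import Literature.NumberTheory.Rogawski1990.ArchChartOrbGSplitCompactProduct   -- ★ (A1) p850949 (LH3-p02 (g4)): §0–§4 (`chartOrbG_eq_prod_mul_integral_prod_pi`, `integrable_comp_symm_archPiEquivCM_descConj_pi_of_regG`, `exists_haar_map_subgroupPiCoords_eq_pi`)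
import Literature.NumberTheory.Rogawski1990.ArchOrbFamGSmoothModel             -- ★ (A4) p850939∕p851054 (LH5-p02): `forall_mem_pi_chartTorusGLoc_comm` (the family `descConj` binder, as consumed by ★ (A4′) p851133)
import HarnessLib

/-!
# `chartOrbG` WITH ONE COMPACT PLACE `w₀` HELD OUT («`{w ∉ S′} = {w₀} ⊔ rest`»; Folland 1995 §2.6 (2.52); Rogawski 1990 §8.2–8.3)

Topic `NumberTheory/Rogawski1990`; namespaces `Literature.MeasureTheory.Group` (§0, generic) and `Literature.NumberTheory.Automorphic.UnitaryGroup` (§1–§2).  THEOREMS ONLY (no `def`,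
no `instance`, no notation, no axiom, no named fact, no `sorry`); kernel lane `--kind proof --supports stmt-HodgeConjecture-24833`.  Cell `pub/hodgecm-mathlib`, crux H413
(`stmt-HodgeConjecture-24833`), F0∕P3c line LH3 (closer stub `stub_N9`), LETTER L1 `HcOrbitalFamiliesStatement`, clause (I₁) «box descent at NON-GENERIC FACE POINTS» (B-desc′):
LH5-p02 (g4)'s (H-core) needs the ONE compact place `w₀` carrying the noncompact coincidence ISOLATED as an outer one-place quotient integral, the other places processed exactly as in
★ (A1)∕(A5a) («ONE EDITION ASK (A5a′) `w₀` HELD OUT», 2026-09-02T10:57:48Z).  This is part 1 (the measure identity for `chartOrbG`); part 2 `ArchOrbFamGUnfoldedModelHeldOut` unfolds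
the split places (★ (A2)+(A3)) on top of it.

CONVENTIONS (`W` = complex places, `U_w = U(α)_w`, `T′_w = chartTorusGLoc α w S′`, `γ_w(c) = gprimeBlockAt α w S′ (c w)`, `e = archPiEquivCM`, `q_w = ν′_w ∕ t_w` the local quotient measures):
the «rest» index is the NESTED subtype `{w : {w // w ∉ S′} // w.1 ≠ w₀}` — it reads into ★ (A4′) `contDiffOn_smoothModel_prod_param` with `e := fun w => w.1.1`, `he := fun w => w.1.2` —,
`M_rest = Π_rest T′_w ≤ Π_rest U_w`, `X_rest = (Π_rest U_w) ⧸ M_rest` with its Weil quotient measure `Q_rest = (⊗_rest ν′_w) ∕ ρ_rest` (`ρ_rest` any inversion-invariant Haar measure on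
`M_rest` with coordinates `⊗ t_w`, ★ `exists_haar_map_subgroupPiCoords_eq_pi`); the `w₀`-slot of a point of `Π_w U_w` is written with Mathlib `Function.update` (coordinates by
`Function.update_self` ∕ `Function.update_of_ne`; the branch `if h₀ : w = w₀ then 1` underneath is junk, overwritten by the update — no transport appears).
* §0 (generic) `measurePreserving_prodLeftComm` ∕ `integral_prod_prodLeftComm` ∕ `integrable_prodLeftComm_iff` — `(a,(b,c)) ↦ (b,(a,c))` on a triple product of s-finite measures
  (Mathlib `Measure.prodAssoc_prod` + `measurePreserving_swap`).
* §1 `exists_measurableEquiv_heldOut` — the held-out coordinates `Φ : (Π_{S′} U⧸T′) × (Π_{∉S′} U⧸T′) ≃ᵐ (Π_{S′} U⧸T′) × ((U_{w₀}⧸T′_{w₀}) × X_rest)`, measure preserving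
  `(⊗_{S′} q) ⊗ (⊗_{∉S′} q) → (⊗_{S′} q) ⊗ (q_{w₀} ⊗ Q_rest)`, with its three coordinate readings (Mathlib `piEquivPiSubtypeProd` at `w = w₀`, `piUnique` on the singleton factor,
  ★ `map_quotientPiHomeomorph_quotientMeasure_pi` on the rest); `heldOut_point_eq` — the point of `Π_w U_w` in held-out form; **`chartOrbG_eq_prod_mul_integral_pi_prod_heldOut`** —
  HYPOTHESIS-FREE twin of ★ (A1) §3: `chartOrbG ν′ S′ a′ c = (∏_w t_w(B′_w)) · ∫ a′ (e⁻¹ (update (w ↦ [w ∈ S′] x_w γ_w(c) x_w⁻¹ ∣ [rest] (g γ_rest(c) g⁻¹)_w) w₀ (x₀ γ_{w₀}(c) x₀⁻¹)))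
  d((⊗_{w∈S′} q_w) ⊗ (q_{w₀} ⊗ Q_rest))` — every `a′`, every `c`.
* §2 at a `G`-REGULAR `c` and `a′ ∈ C_c(G′_∞)`: `integrable_heldOut_of_regG` (transport of ★ (A1) `integrable_comp_symm_archPiEquivCM_descConj_pi_of_regG`) and the ITERATED form
  **`chartOrbG_eq_prod_mul_integral_integral_heldOut_of_regG`** — `w₀` OUTSIDE: `… = (∏ t(B′)) · ∫_{U_{w₀}⧸T′_{w₀}} ( ∫_{(Π_{S′} U⧸T′) × X_rest} … ) dq_{w₀}`.
HONEST LABEL: HC_CM is proved only modulo the 7 printed citations (2 remaining named inputs: hLiu418 = `stmt-HodgeConjecture-24832`, h413 = `stmt-HodgeConjecture-24833`) until rung 0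
closes; count-neutral letter-L1 plumbing.

## References
* [Folland1995] G. B. Folland, *A Course in Abstract Harmonic Analysis* (1995), §2.2, §2.6 Thm. 2.49, (2.52).
* [Gelbart1975] S. Gelbart, *Automorphic Forms on Adele Groups*, Ann. of Math. Studies 83 (1975), §10 p. 155 (10.19).
* [Rogawski1990] J. D. Rogawski, *Automorphic Representations of Unitary Groups in Three Variables*, Ann. of Math. Stud. 123 (1990), §8.2 p. 122, §8.3 pp. 122–124.
* [DeitmarEchterhoff2014] A. Deitmar, S. Echterhoff, *Principles of Harmonic Analysis*, 2nd ed. (2014), Thm. 1.5.3, Lemma 9.3.3.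
-/

set_option autoImplicit false

noncomputable section

open MeasureTheory MeasureTheory.Measure Set NumberField NumberField.InfinitePlace Complex Topology
open Literature.MeasureTheory.Group Literature.NumberTheory.Rogawski1990 Literature.NumberTheory.Automorphic Literature.NumberTheory.Automorphic.UnitaryGroup
open Literature.NumberTheory.Automorphic.ArchCartan
open scoped ContDiff Classical ENNReal NNReal MatrixGroups

namespace Literature.MeasureTheory.Group

/-! ## §0 (generic) Moving the middle factor of a triple product measure to the front -/
section ProdLeftComm
variable {A B C : Type*} [MeasurableSpace A] [MeasurableSpace B] [MeasurableSpace C]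
  (μa : Measure A) (μb : Measure B) (μc : Measure C) [SFinite μa] [SFinite μb] [SFinite μc]

/-- **`(a, (b, c)) ↦ (b, (a, c))` carries `μ_a ⊗ (μ_b ⊗ μ_c)` to `μ_b ⊗ (μ_a ⊗ μ_c)`** (s-finite measures; Mathlib `Measure.prodAssoc_prod` twice around `measurePreserving_swap × id`).
[cite: Folland1995, §2.2] -/
theorem measurePreserving_prodLeftComm :
    MeasurePreserving (fun x : A × (B × C) => (x.2.1, (x.1, x.2.2))) (μa.prod (μb.prod μc)) (μb.prod (μa.prod μc)) := by
  have h1 : MeasurePreserving (MeasurableEquiv.prodAssoc.symm : A × (B × C) ≃ᵐ (A × B) × C) (μa.prod (μb.prod μc)) ((μa.prod μb).prod μc) :=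
    (⟨MeasurableEquiv.prodAssoc.measurable, Measure.prodAssoc_prod⟩ :
      MeasurePreserving (MeasurableEquiv.prodAssoc : (A × B) × C ≃ᵐ A × (B × C)) ((μa.prod μb).prod μc) (μa.prod (μb.prod μc))).symm _
  have h2 : MeasurePreserving (Prod.map Prod.swap id : (A × B) × C → (B × A) × C) ((μa.prod μb).prod μc) ((μb.prod μa).prod μc) :=
    Measure.measurePreserving_swap.prod (MeasurePreserving.id μc)
  have h3 : MeasurePreserving (MeasurableEquiv.prodAssoc : (B × A) × C ≃ᵐ B × (A × C)) ((μb.prod μa).prod μc) (μb.prod (μa.prod μc)) :=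
    ⟨MeasurableEquiv.prodAssoc.measurable, Measure.prodAssoc_prod⟩
  have heq : (fun x : A × (B × C) => (x.2.1, (x.1, x.2.2))) =
      (MeasurableEquiv.prodAssoc : (B × A) × C ≃ᵐ B × (A × C)) ∘ (Prod.map Prod.swap id : (A × B) × C → (B × A) × C) ∘
        (MeasurableEquiv.prodAssoc.symm : A × (B × C) ≃ᵐ (A × B) × C) := by
    funext x
    rfl
  rw [heq]
  exact h3.comp (h2.comp h1)

/-- **Change of variables `(a, (b, c)) ↦ (b, (a, c))` in a Bochner integral against a triple product measure** (no integrability needed: the map is a measurable equivalence).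
[cite: Folland1995, §2.2] -/
theorem integral_prod_prodLeftComm {E : Type*} [NormedAddCommGroup E] [NormedSpace ℝ E] (f : A × (B × C) → E) :
    ∫ x, f x ∂(μa.prod (μb.prod μc)) = ∫ y : B × (A × C), f (y.2.1, (y.1, y.2.2)) ∂(μb.prod (μa.prod μc)) := by
  have h := (measurePreserving_prodLeftComm μb μa μc).integral_comp
    ((MeasurableEquiv.prodAssoc.symm.trans ((MeasurableEquiv.prodCongr MeasurableEquiv.prodComm (MeasurableEquiv.refl C)).trans MeasurableEquiv.prodAssoc)) :
      B × (A × C) ≃ᵐ A × (B × C)).measurableEmbedding f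
  exact h.symm

/-- **Integrability transfers along `(a, (b, c)) ↦ (b, (a, c))`.** [cite: Folland1995, §2.2] -/
theorem integrable_prodLeftComm_iff {E : Type*} [NormedAddCommGroup E] (f : A × (B × C) → E) :
    Integrable (fun y : B × (A × C) => f (y.2.1, (y.1, y.2.2))) (μb.prod (μa.prod μc)) ↔ Integrable f (μa.prod (μb.prod μc)) :=
  (measurePreserving_prodLeftComm μb μa μc).integrable_comp_emb
    ((MeasurableEquiv.prodAssoc.symm.trans ((MeasurableEquiv.prodCongr MeasurableEquiv.prodComm (MeasurableEquiv.refl C)).trans MeasurableEquiv.prodAssoc)) :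
      B × (A × C) ≃ᵐ A × (B × C)).measurableEmbedding

end ProdLeftComm
end Literature.MeasureTheory.Group

namespace Literature.NumberTheory.Automorphic.UnitaryGroup

/-! ## §1 `chartOrbG` with the compact place `w₀` HELD OUT — hypothesis-free -/

section HeldOut
variable (L : Type) [Field L] [NumberField L] [IsCMField L] (α : Fin 3 → L) (S' : Finset {w : InfinitePlace L // IsComplex w})
  [∀ w : {w : InfinitePlace L // IsComplex w}, MeasurableSpace ↥(archLocal L 3 (Matrix.diagonal α) w)]
  [∀ w : {w : InfinitePlace L // IsComplex w}, BorelSpace ↥(archLocal L 3 (Matrix.diagonal α) w)]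
  [∀ w : {w : InfinitePlace L // IsComplex w}, LocallyCompactSpace ↥(archLocal L 3 (Matrix.diagonal α) w)]
  [∀ w : {w : InfinitePlace L // IsComplex w}, SecondCountableTopology ↥(archLocal L 3 (Matrix.diagonal α) w)]
  [MeasurableSpace ↥(arch (↥(maximalRealSubfield L)) L (IsCMField.complexConj L) 3 (Matrix.diagonal α))]
  [BorelSpace ↥(arch (↥(maximalRealSubfield L)) L (IsCMField.complexConj L) 3 (Matrix.diagonal α))]
  [∀ w : {w : InfinitePlace L // IsComplex w}, MeasurableSpace (↥(archLocal L 3 (Matrix.diagonal α) w) ⧸ chartTorusGLoc L α w S')]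
  [∀ w : {w : InfinitePlace L // IsComplex w}, BorelSpace (↥(archLocal L 3 (Matrix.diagonal α) w) ⧸ chartTorusGLoc L α w S')]
  (ν'w : ∀ w : {w : InfinitePlace L // IsComplex w}, Measure ↥(archLocal L 3 (Matrix.diagonal α) w)) [∀ w, (ν'w w).IsHaarMeasure] [∀ w, (ν'w w).IsMulRightInvariant]
  (ν' : Measure ↥(arch (↥(maximalRealSubfield L)) L (IsCMField.complexConj L) 3 (Matrix.diagonal α))) [ν'.IsHaarMeasure] [ν'.IsMulRightInvariant]
  (hν : ν' = (Measure.pi ν'w).map (archPiEquivCM 3 L (Matrix.diagonal α)).symm)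
  (t : ∀ w : {w : InfinitePlace L // IsComplex w}, Measure ↥(chartTorusGLoc L α w S')) [∀ w, (t w).IsHaarMeasure] [∀ w, (t w).IsInvInvariant]
  -- the held-out compact place `w₀ ∉ S′` and the rest factor `(Π_{w ∉ S′, w ≠ w₀} U_w) ⧸ Π T′_w`
  {w₀ : {w : InfinitePlace L // IsComplex w}} (hw₀ : w₀ ∉ S')
  [MeasurableSpace ((∀ w : {w : {w : {w : InfinitePlace L // IsComplex w} // w ∉ S'} // w.1 ≠ w₀}, ↥(archLocal L 3 (Matrix.diagonal α) w.1.1)) ⧸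
    Subgroup.pi Set.univ (fun w : {w : {w : {w : InfinitePlace L // IsComplex w} // w ∉ S'} // w.1 ≠ w₀} => chartTorusGLoc L α w.1.1 S'))]
  [BorelSpace ((∀ w : {w : {w : {w : InfinitePlace L // IsComplex w} // w ∉ S'} // w.1 ≠ w₀}, ↥(archLocal L 3 (Matrix.diagonal α) w.1.1)) ⧸
    Subgroup.pi Set.univ (fun w : {w : {w : {w : InfinitePlace L // IsComplex w} // w ∉ S'} // w.1 ≠ w₀} => chartTorusGLoc L α w.1.1 S'))]
  (ρrest : Measure ↥(Subgroup.pi Set.univ (fun w : {w : {w : {w : InfinitePlace L // IsComplex w} // w ∉ S'} // w.1 ≠ w₀} => chartTorusGLoc L α w.1.1 S')))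
  [ρrest.IsHaarMeasure] [ρrest.IsInvInvariant]
  (hρ : Measure.map (subgroupPiCoords fun w : {w : {w : {w : InfinitePlace L // IsComplex w} // w ∉ S'} // w.1 ≠ w₀} => chartTorusGLoc L α w.1.1 S') ρrest =
    Measure.pi fun w : {w : {w : {w : InfinitePlace L // IsComplex w} // w ∉ S'} // w.1 ≠ w₀} => t w.1.1)

omit [MeasurableSpace ↥(arch (↥(maximalRealSubfield L)) L (IsCMField.complexConj L) 3 (Matrix.diagonal α))]
  [BorelSpace ↥(arch (↥(maximalRealSubfield L)) L (IsCMField.complexConj L) 3 (Matrix.diagonal α))] in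
include hρ hw₀ in
/-- **THE HELD-OUT COORDINATES ON THE COMPACT HALF** — a measure-preserving equivalence
`Φ : (Π_{w∈S′} U_w⧸T′_w) × (Π_{w∉S′} U_w⧸T′_w) ≃ᵐ (Π_{w∈S′} U_w⧸T′_w) × ((U_{w₀}⧸T′_{w₀}) × ((Π_{w∉S′, w≠w₀} U_w) ⧸ Π T′_w))` from `(⊗_{S′} q_w) ⊗ (⊗_{∉S′} q_w)` to
`(⊗_{S′} q_w) ⊗ (q_{w₀} ⊗ Q_rest)` READING `Φ(x).1 = x.1`, `Φ(x).2.1 = x.2 w₀`, `Φ(x).2.2 = qπ⁻¹ (x.2|_rest)` (`qπ` = ★ `quotientPiHomeomorph`): Mathlib `piEquivPiSubtypeProd` at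
`w = w₀` on the compact half, `piUnique` on the singleton factor, ★ `map_quotientPiHomeomorph_quotientMeasure_pi` (`hρ`) on the rest. [cite: Folland1995, §2.2; §2.6 Thm. 2.49, (2.52)] -/
theorem exists_measurableEquiv_heldOut :
    ∃ Φ : ((∀ w : {w : {w : InfinitePlace L // IsComplex w} // w ∈ S'}, ↥(archLocal L 3 (Matrix.diagonal α) w.1) ⧸ chartTorusGLoc L α w.1 S') ×
        (∀ w : {w : {w : InfinitePlace L // IsComplex w} // w ∉ S'}, ↥(archLocal L 3 (Matrix.diagonal α) w.1) ⧸ chartTorusGLoc L α w.1 S')) ≃ᵐ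
      ((∀ w : {w : {w : InfinitePlace L // IsComplex w} // w ∈ S'}, ↥(archLocal L 3 (Matrix.diagonal α) w.1) ⧸ chartTorusGLoc L α w.1 S') ×
        ((↥(archLocal L 3 (Matrix.diagonal α) w₀) ⧸ chartTorusGLoc L α w₀ S') ×
          ((∀ w : {w : {w : {w : InfinitePlace L // IsComplex w} // w ∉ S'} // w.1 ≠ w₀}, ↥(archLocal L 3 (Matrix.diagonal α) w.1.1)) ⧸
            Subgroup.pi Set.univ (fun w : {w : {w : {w : InfinitePlace L // IsComplex w} // w ∉ S'} // w.1 ≠ w₀} => chartTorusGLoc L α w.1.1 S')))),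
      MeasurePreserving Φ
        ((Measure.pi fun w : {w : {w : InfinitePlace L // IsComplex w} // w ∈ S'} =>
          quotientMeasure (chartTorusGLoc L α w.1 S') (t w.1) (isClosed_chartTorusGLoc L α w.1 S') (ν'w w.1)).prod
        (Measure.pi fun w : {w : {w : InfinitePlace L // IsComplex w} // w ∉ S'} =>
          quotientMeasure (chartTorusGLoc L α w.1 S') (t w.1) (isClosed_chartTorusGLoc L α w.1 S') (ν'w w.1)))
        ((Measure.pi fun w : {w : {w : InfinitePlace L // IsComplex w} // w ∈ S'} =>
          quotientMeasure (chartTorusGLoc L α w.1 S') (t w.1) (isClosed_chartTorusGLoc L α w.1 S') (ν'w w.1)).prod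
        ((quotientMeasure (chartTorusGLoc L α w₀ S') (t w₀) (isClosed_chartTorusGLoc L α w₀ S') (ν'w w₀)).prod
          (quotientMeasure (Subgroup.pi Set.univ (fun w : {w : {w : {w : InfinitePlace L // IsComplex w} // w ∉ S'} // w.1 ≠ w₀} => chartTorusGLoc L α w.1.1 S')) ρrest
            (isClosed_coe_pi _ fun w => isClosed_chartTorusGLoc L α w.1.1 S')
            (Measure.pi fun w : {w : {w : {w : InfinitePlace L // IsComplex w} // w ∉ S'} // w.1 ≠ w₀} => ν'w w.1.1)))) ∧
      ∀ x, (Φ x).1 = x.1 ∧ (Φ x).2.1 = x.2 ⟨w₀, hw₀⟩ ∧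
        (Φ x).2.2 = (quotientPiHomeomorph fun w : {w : {w : {w : InfinitePlace L // IsComplex w} // w ∉ S'} // w.1 ≠ w₀} => chartTorusGLoc L α w.1.1 S').symm (fun w : {w : {w : {w : InfinitePlace L // IsComplex w} // w ∉ S'} // w.1 ≠ w₀} => x.2 w.1) := by
  haveI : ∀ w : {w : InfinitePlace L // IsComplex w}, IsClosed (chartTorusGLoc L α w S' : Set ↥(archLocal L 3 (Matrix.diagonal α) w)) :=
    fun w => isClosed_chartTorusGLoc L α w S'
  haveI : ∀ w : {w : InfinitePlace L // IsComplex w}, SecondCountableTopology (↥(archLocal L 3 (Matrix.diagonal α) w) ⧸ chartTorusGLoc L α w S') := fun w => inferInstance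
  haveI : ∀ w : {w : InfinitePlace L // IsComplex w},
      SigmaFinite (quotientMeasure (chartTorusGLoc L α w S') (t w) (isClosed_chartTorusGLoc L α w S') (ν'w w)) := fun w => inferInstance
  haveI : ∀ w, LocallyCompactSpace ↥(chartTorusGLoc L α w S') := fun w => locallyCompactSpace_chartTorusGLoc L α w S'
  haveI : ∀ w, SecondCountableTopology ↥(chartTorusGLoc L α w S') := fun w => TopologicalSpace.Subtype.secondCountableTopology _
  haveI : ∀ w, SigmaFinite (t w) := fun w => inferInstance
  have hMc : IsClosed ((Subgroup.pi Set.univ (fun w : {w : {w : {w : InfinitePlace L // IsComplex w} // w ∉ S'} // w.1 ≠ w₀} => chartTorusGLoc L α w.1.1 S')) :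
      Set (∀ w : {w : {w : {w : InfinitePlace L // IsComplex w} // w ∉ S'} // w.1 ≠ w₀}, ↥(archLocal L 3 (Matrix.diagonal α) w.1.1))) :=
    isClosed_coe_pi _ fun w => isClosed_chartTorusGLoc L α w.1.1 S'
  haveI : LocallyCompactSpace ↥(Subgroup.pi Set.univ (fun w : {w : {w : {w : InfinitePlace L // IsComplex w} // w ∉ S'} // w.1 ≠ w₀} => chartTorusGLoc L α w.1.1 S')) :=
    hMc.isClosedEmbedding_subtypeVal.locallyCompactSpace
  haveI : SecondCountableTopology ↥(Subgroup.pi Set.univ (fun w : {w : {w : {w : InfinitePlace L // IsComplex w} // w ∉ S'} // w.1 ≠ w₀} => chartTorusGLoc L α w.1.1 S')) :=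
    TopologicalSpace.Subtype.secondCountableTopology _
  haveI : SFinite ρrest := inferInstance
  -- the singleton index `{w // w ∉ S′, w = w₀}`, with `default := ⟨⟨w₀, hw₀⟩, rfl⟩` DEFINITIONALLY (a `letI`, so that `piUnique` evaluates at `w₀` by `rfl`)
  letI iU : Unique {w : {w : {w : InfinitePlace L // IsComplex w} // w ∉ S'} // w.1 = w₀} :=
    { default := ⟨⟨w₀, hw₀⟩, rfl⟩, uniq := fun w => Subtype.ext (Subtype.ext w.2) }
  -- the three measure-preserving pieces on the compact half: index split at `w₀`, the singleton factor, the rest as ONE quotient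
  have hsplit := measurePreserving_piEquivPiSubtypeProd'
    (fun w : {w : {w : InfinitePlace L // IsComplex w} // w ∉ S'} =>
      quotientMeasure (chartTorusGLoc L α w.1 S') (t w.1) (isClosed_chartTorusGLoc L α w.1 S') (ν'w w.1))
    (fun w : {w : {w : InfinitePlace L // IsComplex w} // w ∉ S'} => w.1 = w₀)
  have hU : MeasurePreserving
      (MeasurableEquiv.piUnique fun w : {w : {w : {w : InfinitePlace L // IsComplex w} // w ∉ S'} // w.1 = w₀} =>
        ↥(archLocal L 3 (Matrix.diagonal α) w.1.1) ⧸ chartTorusGLoc L α w.1.1 S')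
      (Measure.pi fun w : {w : {w : {w : InfinitePlace L // IsComplex w} // w ∉ S'} // w.1 = w₀} =>
        quotientMeasure (chartTorusGLoc L α w.1.1 S') (t w.1.1) (isClosed_chartTorusGLoc L α w.1.1 S') (ν'w w.1.1))
      (quotientMeasure (chartTorusGLoc L α w₀ S') (t w₀) (isClosed_chartTorusGLoc L α w₀ S') (ν'w w₀)) :=
    measurePreserving_piUnique _
  have hq : MeasurePreserving (quotientPiHomeomorph fun w : {w : {w : {w : InfinitePlace L // IsComplex w} // w ∉ S'} // w.1 ≠ w₀} => chartTorusGLoc L α w.1.1 S').symm.toMeasurableEquiv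
      (Measure.pi fun w : {w : {w : {w : InfinitePlace L // IsComplex w} // w ∉ S'} // w.1 ≠ w₀} =>
        quotientMeasure (chartTorusGLoc L α w.1.1 S') (t w.1.1) (isClosed_chartTorusGLoc L α w.1.1 S') (ν'w w.1.1))
      (quotientMeasure (Subgroup.pi Set.univ (fun w : {w : {w : {w : InfinitePlace L // IsComplex w} // w ∉ S'} // w.1 ≠ w₀} => chartTorusGLoc L α w.1.1 S')) ρrest
            (isClosed_coe_pi _ fun w => isClosed_chartTorusGLoc L α w.1.1 S')
            (Measure.pi fun w : {w : {w : {w : InfinitePlace L // IsComplex w} // w ∉ S'} // w.1 ≠ w₀} => ν'w w.1.1)) := by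
    refine MeasurePreserving.symm _ ⟨(quotientPiHomeomorph fun w : {w : {w : {w : InfinitePlace L // IsComplex w} // w ∉ S'} // w.1 ≠ w₀} => chartTorusGLoc L α w.1.1 S').toMeasurableEquiv.measurable, ?_⟩
    rw [Homeomorph.toMeasurableEquiv_coe]
    exact map_quotientPiHomeomorph_quotientMeasure_pi (fun w : {w : {w : {w : InfinitePlace L // IsComplex w} // w ∉ S'} // w.1 ≠ w₀} => chartTorusGLoc L α w.1.1 S')
      (fun w => isClosed_chartTorusGLoc L α w.1.1 S') (fun w => t w.1.1) ρrest hρ (fun w => ν'w w.1.1)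
  refine ⟨MeasurableEquiv.prodCongr (MeasurableEquiv.refl _)
      ((MeasurableEquiv.piEquivPiSubtypeProd
          (fun w : {w : {w : InfinitePlace L // IsComplex w} // w ∉ S'} => ↥(archLocal L 3 (Matrix.diagonal α) w.1) ⧸ chartTorusGLoc L α w.1 S')
          (fun w : {w : {w : InfinitePlace L // IsComplex w} // w ∉ S'} => w.1 = w₀)).trans
        (MeasurableEquiv.prodCongr
          (MeasurableEquiv.piUnique fun w : {w : {w : {w : InfinitePlace L // IsComplex w} // w ∉ S'} // w.1 = w₀} =>
            ↥(archLocal L 3 (Matrix.diagonal α) w.1.1) ⧸ chartTorusGLoc L α w.1.1 S')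
          (quotientPiHomeomorph fun w : {w : {w : {w : InfinitePlace L // IsComplex w} // w ∉ S'} // w.1 ≠ w₀} => chartTorusGLoc L α w.1.1 S').symm.toMeasurableEquiv)),
    (MeasurePreserving.id _).prod ((hU.prod hq).comp hsplit), fun x => ⟨rfl, rfl, rfl⟩⟩

omit [∀ w : {w : InfinitePlace L // IsComplex w}, MeasurableSpace ↥(archLocal L 3 (Matrix.diagonal α) w)]
  [∀ w : {w : InfinitePlace L // IsComplex w}, BorelSpace ↥(archLocal L 3 (Matrix.diagonal α) w)]
  [∀ w : {w : InfinitePlace L // IsComplex w}, LocallyCompactSpace ↥(archLocal L 3 (Matrix.diagonal α) w)]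
  [∀ w : {w : InfinitePlace L // IsComplex w}, SecondCountableTopology ↥(archLocal L 3 (Matrix.diagonal α) w)]
  [MeasurableSpace ↥(arch (↥(maximalRealSubfield L)) L (IsCMField.complexConj L) 3 (Matrix.diagonal α))]
  [BorelSpace ↥(arch (↥(maximalRealSubfield L)) L (IsCMField.complexConj L) 3 (Matrix.diagonal α))]
  [∀ w : {w : InfinitePlace L // IsComplex w}, MeasurableSpace (↥(archLocal L 3 (Matrix.diagonal α) w) ⧸ chartTorusGLoc L α w S')]
  [∀ w : {w : InfinitePlace L // IsComplex w}, BorelSpace (↥(archLocal L 3 (Matrix.diagonal α) w) ⧸ chartTorusGLoc L α w S')]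
  [MeasurableSpace ((∀ w : {w : {w : {w : InfinitePlace L // IsComplex w} // w ∉ S'} // w.1 ≠ w₀}, ↥(archLocal L 3 (Matrix.diagonal α) w.1.1)) ⧸
    Subgroup.pi Set.univ (fun w : {w : {w : {w : InfinitePlace L // IsComplex w} // w ∉ S'} // w.1 ≠ w₀} => chartTorusGLoc L α w.1.1 S'))]
  [BorelSpace ((∀ w : {w : {w : {w : InfinitePlace L // IsComplex w} // w ∉ S'} // w.1 ≠ w₀}, ↥(archLocal L 3 (Matrix.diagonal α) w.1.1)) ⧸
    Subgroup.pi Set.univ (fun w : {w : {w : {w : InfinitePlace L // IsComplex w} // w ∉ S'} // w.1 ≠ w₀} => chartTorusGLoc L α w.1.1 S'))] in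
/-- **THE HELD-OUT READING OF A POINT** (pure bookkeeping, no measure): for classes `x₁` at the split places and `x₂` at the compact places,
`(w ↦ z_w γ_w(c) z_w⁻¹)` (`z = x₁` on `S′`, `= x₂` off `S′`, the (A1) §2 point) EQUALS `update (w ↦ [w ∈ S′] x₁,w γ_w x₁,w⁻¹ ∣ [w ∉ S′, w ≠ w₀] (G γ_rest(c) G⁻¹)_w) w₀ (x₂,w₀ γ_{w₀} x₂,w₀⁻¹)`
with `G M_rest = qπ⁻¹ (x₂|_rest)` — coordinates by `Function.update_self` ∕ `Function.update_of_ne`, ★ `quotientPiEquiv_mk`, ★ `descConj_mk`. [cite: Rogawski1990, §8.2 p. 122] -/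
theorem heldOut_point_eq (c : {w : InfinitePlace L // IsComplex w} → Fin 3 → ℝ)
    (x₁ : ∀ w : {w : {w : InfinitePlace L // IsComplex w} // w ∈ S'}, ↥(archLocal L 3 (Matrix.diagonal α) w.1) ⧸ chartTorusGLoc L α w.1 S')
    (x₂ : ∀ w : {w : {w : InfinitePlace L // IsComplex w} // w ∉ S'}, ↥(archLocal L 3 (Matrix.diagonal α) w.1) ⧸ chartTorusGLoc L α w.1 S') :
    (fun w : {w : InfinitePlace L // IsComplex w} =>
      descConj (gprimeBlockAt L α w S' (c w)) (chartTorusGLoc L α w S') (forall_mem_chartTorusGLoc_comm L α w S' (c w)) id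
        (if h : w ∈ S' then x₁ ⟨w, h⟩ else x₂ ⟨w, h⟩)) =
      Function.update (fun w =>
        if h : w ∈ S' then
          descConj (gprimeBlockAt L α w S' (c w)) (chartTorusGLoc L α w S') (forall_mem_chartTorusGLoc_comm L α w S' (c w)) id (x₁ ⟨w, h⟩)
        else if h₀ : w = w₀ then 1
        else
          descConj (fun w : {w : {w : {w : InfinitePlace L // IsComplex w} // w ∉ S'} // w.1 ≠ w₀} => gprimeBlock L α w.1.1 S' c)
            (Subgroup.pi Set.univ (fun w : {w : {w : {w : InfinitePlace L // IsComplex w} // w ∉ S'} // w.1 ≠ w₀} => chartTorusGLoc L α w.1.1 S'))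
            (forall_mem_pi_chartTorusGLoc_comm L α S' (fun w : {w : {w : {w : InfinitePlace L // IsComplex w} // w ∉ S'} // w.1 ≠ w₀} => w.1.1) c)
            (fun g => (g ⟨⟨w, h⟩, h₀⟩ : ↥(archLocal L 3 (Matrix.diagonal α) w)))
            ((quotientPiHomeomorph fun w : {w : {w : {w : InfinitePlace L // IsComplex w} // w ∉ S'} // w.1 ≠ w₀} => chartTorusGLoc L α w.1.1 S').symm (fun w : {w : {w : {w : InfinitePlace L // IsComplex w} // w ∉ S'} // w.1 ≠ w₀} => x₂ w.1)))
        w₀ (descConj (gprimeBlockAt L α w₀ S' (c w₀)) (chartTorusGLoc L α w₀ S') (forall_mem_chartTorusGLoc_comm L α w₀ S' (c w₀)) id (x₂ ⟨w₀, hw₀⟩)) := by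
  -- a representative of the rest class, read back coordinate-wise through `qπ`
  obtain ⟨G, hG⟩ := QuotientGroup.mk_surjective ((quotientPiHomeomorph fun w : {w : {w : {w : InfinitePlace L // IsComplex w} // w ∉ S'} // w.1 ≠ w₀} => chartTorusGLoc L α w.1.1 S').symm (fun w : {w : {w : {w : InfinitePlace L // IsComplex w} // w ∉ S'} // w.1 ≠ w₀} => x₂ w.1))
  have hz : ∀ (w : {w : InfinitePlace L // IsComplex w}) (h : w ∉ S') (hw : w ≠ w₀),
      x₂ ⟨w, h⟩ = (quotientPiHomeomorph fun w : {w : {w : {w : InfinitePlace L // IsComplex w} // w ∉ S'} // w.1 ≠ w₀} => chartTorusGLoc L α w.1.1 S') (QuotientGroup.mk G) ⟨⟨w, h⟩, hw⟩ := by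
    intro w h hw
    have hGw := congrFun (congrArg (quotientPiHomeomorph fun w : {w : {w : {w : InfinitePlace L // IsComplex w} // w ∉ S'} // w.1 ≠ w₀} => chartTorusGLoc L α w.1.1 S') hG) ⟨⟨w, h⟩, hw⟩
    rw [Homeomorph.apply_symm_apply] at hGw
    exact hGw.symm
  rw [← hG]
  funext w
  by_cases hw : w = w₀
  · subst w
    rw [Function.update_self, dif_neg hw₀]
  · rw [Function.update_of_ne hw]
    by_cases h : w ∈ S'
    · rw [dif_pos h, dif_pos h]
    · rw [dif_neg h, dif_neg h, dif_neg hw, hz w h hw, descConj_mk, coe_quotientPiHomeomorph, quotientPiEquiv_mk, descConj_mk]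
      rfl

include hν hρ hw₀ in
/-- **(A1′) `chartOrbG` WITH THE COMPACT PLACE `w₀` HELD OUT — HYPOTHESIS-FREE.**  For admissible `S′` (`hα`, `hS′`), ANY inversion-invariant Haar family `t_w` on the local chart tori,
a compact-chart place `w₀ ∉ S′`, and ANY inversion-invariant Haar `ρ_rest` on `M_rest := Π_{w ∉ S′, w ≠ w₀} T′_w` with coordinates `⊗ t_w` (`hρ`; supplied by ★ `exists_haar_map_subgroupPiCoords_eq_pi`),
EVERY test function `a′` and EVERY coordinate `c`:
`chartOrbG ν′ S′ a′ c = (∏_w t_w(B′_w)) · ∫ a′ (e⁻¹ (update (w ↦ [w ∈ S′] x_w γ_w(c) x_w⁻¹ ∣ [w ∉ S′, w ≠ w₀] (g γ_rest(c) g⁻¹)_w) w₀ (x₀ γ_{w₀}(c) x₀⁻¹))) d((⊗_{w∈S′} q_w) ⊗ (q_{w₀} ⊗ Q_rest))(x, x₀, gM_rest)`,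
`q_w = ν′_w ∕ t_w`, `Q_rest = (⊗_rest ν′_w) ∕ ρ_rest` — the split variables and the `w₀`-variable in LOCAL `descConj (γ_w(c)) T′_w _ id` currency, the remaining compact variables through ONE
`descConj (γ_rest(c)) M_rest _` (what ★ (A4′) differentiates).  ★ (A1) §2 + the held-out coordinates `exists_measurableEquiv_heldOut` + `heldOut_point_eq` (Bochner change of variables
along a measure-preserving equivalence; no Fubini, no integrability). [cite: Folland1995, §2.6 Thm. 2.49, (2.52)] [cite: Gelbart1975, p. 155 (10.19)] [cite: Rogawski1990, §8.2 p. 122; §8.3 p. 124] -/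
theorem chartOrbG_eq_prod_mul_integral_pi_prod_heldOut (hα : ∀ i, α i ≠ 0) (hS' : ∀ w, w ∈ S' → w ∈ splitChartPlaces L α)
    (a' : ↥(arch (↥(maximalRealSubfield L)) L (IsCMField.complexConj L) 3 (Matrix.diagonal α)) → ℂ)
    (c : {w : InfinitePlace L // IsComplex w} → Fin 3 → ℝ) :
    chartOrbG L α ν' S' a' c =
      (∏ w, ((t w (chartBoxImgGLoc L α w S')).toReal : ℂ)) *
        ∫ x : (∀ w : {w : {w : InfinitePlace L // IsComplex w} // w ∈ S'}, ↥(archLocal L 3 (Matrix.diagonal α) w.1) ⧸ chartTorusGLoc L α w.1 S') ×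
            ((↥(archLocal L 3 (Matrix.diagonal α) w₀) ⧸ chartTorusGLoc L α w₀ S') ×
              ((∀ w : {w : {w : {w : InfinitePlace L // IsComplex w} // w ∉ S'} // w.1 ≠ w₀}, ↥(archLocal L 3 (Matrix.diagonal α) w.1.1)) ⧸
            Subgroup.pi Set.univ (fun w : {w : {w : {w : InfinitePlace L // IsComplex w} // w ∉ S'} // w.1 ≠ w₀} => chartTorusGLoc L α w.1.1 S'))),
          a' ((archPiEquivCM 3 L (Matrix.diagonal α)).symm (Function.update (fun w =>
            if h : w ∈ S' then
              descConj (gprimeBlockAt L α w S' (c w)) (chartTorusGLoc L α w S') (forall_mem_chartTorusGLoc_comm L α w S' (c w)) id (x.1 ⟨w, h⟩)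
            else if h₀ : w = w₀ then 1
            else
              descConj (fun w : {w : {w : {w : InfinitePlace L // IsComplex w} // w ∉ S'} // w.1 ≠ w₀} => gprimeBlock L α w.1.1 S' c)
                (Subgroup.pi Set.univ (fun w : {w : {w : {w : InfinitePlace L // IsComplex w} // w ∉ S'} // w.1 ≠ w₀} => chartTorusGLoc L α w.1.1 S'))
                (forall_mem_pi_chartTorusGLoc_comm L α S' (fun w : {w : {w : {w : InfinitePlace L // IsComplex w} // w ∉ S'} // w.1 ≠ w₀} => w.1.1) c)
                (fun g => (g ⟨⟨w, h⟩, h₀⟩ : ↥(archLocal L 3 (Matrix.diagonal α) w))) x.2.2)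
          w₀ (descConj (gprimeBlockAt L α w₀ S' (c w₀)) (chartTorusGLoc L α w₀ S') (forall_mem_chartTorusGLoc_comm L α w₀ S' (c w₀)) id x.2.1)))
          ∂((Measure.pi fun w : {w : {w : InfinitePlace L // IsComplex w} // w ∈ S'} =>
          quotientMeasure (chartTorusGLoc L α w.1 S') (t w.1) (isClosed_chartTorusGLoc L α w.1 S') (ν'w w.1)).prod
        ((quotientMeasure (chartTorusGLoc L α w₀ S') (t w₀) (isClosed_chartTorusGLoc L α w₀ S') (ν'w w₀)).prod
          (quotientMeasure (Subgroup.pi Set.univ (fun w : {w : {w : {w : InfinitePlace L // IsComplex w} // w ∉ S'} // w.1 ≠ w₀} => chartTorusGLoc L α w.1.1 S')) ρrest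
            (isClosed_coe_pi _ fun w => isClosed_chartTorusGLoc L α w.1.1 S')
            (Measure.pi fun w : {w : {w : {w : InfinitePlace L // IsComplex w} // w ∉ S'} // w.1 ≠ w₀} => ν'w w.1.1)))) := by
  haveI : ∀ w : {w : InfinitePlace L // IsComplex w}, SecondCountableTopology (↥(archLocal L 3 (Matrix.diagonal α) w) ⧸ chartTorusGLoc L α w S') := fun w => inferInstance
  haveI : ∀ w : {w : InfinitePlace L // IsComplex w},
      SigmaFinite (quotientMeasure (chartTorusGLoc L α w S') (t w) (isClosed_chartTorusGLoc L α w S') (ν'w w)) := fun w => inferInstance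
  rw [chartOrbG_eq_prod_mul_integral_prod_pi L α S' ν'w ν' hν t hα hS' a' c]
  congr 1
  obtain ⟨Φ, hΦ, hΦx⟩ := exists_measurableEquiv_heldOut L α S' ν'w t hw₀ ρrest hρ
  rw [← hΦ.integral_comp' (f := Φ)]
  refine integral_congr_ae (Filter.Eventually.of_forall fun x => ?_)
  obtain ⟨x₁, x₂⟩ := x
  obtain ⟨h1, h2, h3⟩ := hΦx (x₁, x₂)
  dsimp only
  rw [h1, h2, h3, heldOut_point_eq L α S' hw₀ c x₁ x₂]

/-! ## §2 At a `G`-regular point: integrability of the held-out integrand and the ITERATED form, `w₀` OUTSIDE -/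

include hν hρ hw₀ in
/-- **The held-out integrand of §1 is integrable at every `G`-REGULAR `c` for `a′ ∈ C_c(G′_∞)`** — ★ (A1) `integrable_comp_symm_archPiEquivCM_descConj_pi_of_regG` transported along
Mathlib `piEquivPiSubtypeProd` and the held-out coordinates `Φ` (`MeasurePreserving.integrable_comp_emb`). [cite: Rogawski1990, §8.3 p. 122] [cite: DeitmarEchterhoff2014, Lemma 9.3.3] -/
theorem integrable_heldOut_of_regG (hα : ∀ i, α i ≠ 0) (hS' : ∀ w, w ∈ S' → w ∈ splitChartPlaces L α)
    {c : {w : InfinitePlace L // IsComplex w} → Fin 3 → ℝ} (hc : c ∈ RegG S')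
    {a' : ↥(arch (↥(maximalRealSubfield L)) L (IsCMField.complexConj L) 3 (Matrix.diagonal α)) → ℂ} (ha'c : Continuous a') (ha's : HasCompactSupport a') :
    Integrable (fun x : (∀ w : {w : {w : InfinitePlace L // IsComplex w} // w ∈ S'}, ↥(archLocal L 3 (Matrix.diagonal α) w.1) ⧸ chartTorusGLoc L α w.1 S') ×
            ((↥(archLocal L 3 (Matrix.diagonal α) w₀) ⧸ chartTorusGLoc L α w₀ S') ×
              ((∀ w : {w : {w : {w : InfinitePlace L // IsComplex w} // w ∉ S'} // w.1 ≠ w₀}, ↥(archLocal L 3 (Matrix.diagonal α) w.1.1)) ⧸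
            Subgroup.pi Set.univ (fun w : {w : {w : {w : InfinitePlace L // IsComplex w} // w ∉ S'} // w.1 ≠ w₀} => chartTorusGLoc L α w.1.1 S'))) =>
          a' ((archPiEquivCM 3 L (Matrix.diagonal α)).symm (Function.update (fun w =>
            if h : w ∈ S' then
              descConj (gprimeBlockAt L α w S' (c w)) (chartTorusGLoc L α w S') (forall_mem_chartTorusGLoc_comm L α w S' (c w)) id (x.1 ⟨w, h⟩)
            else if h₀ : w = w₀ then 1
            else
              descConj (fun w : {w : {w : {w : InfinitePlace L // IsComplex w} // w ∉ S'} // w.1 ≠ w₀} => gprimeBlock L α w.1.1 S' c)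
                (Subgroup.pi Set.univ (fun w : {w : {w : {w : InfinitePlace L // IsComplex w} // w ∉ S'} // w.1 ≠ w₀} => chartTorusGLoc L α w.1.1 S'))
                (forall_mem_pi_chartTorusGLoc_comm L α S' (fun w : {w : {w : {w : InfinitePlace L // IsComplex w} // w ∉ S'} // w.1 ≠ w₀} => w.1.1) c)
                (fun g => (g ⟨⟨w, h⟩, h₀⟩ : ↥(archLocal L 3 (Matrix.diagonal α) w))) x.2.2)
          w₀ (descConj (gprimeBlockAt L α w₀ S' (c w₀)) (chartTorusGLoc L α w₀ S') (forall_mem_chartTorusGLoc_comm L α w₀ S' (c w₀)) id x.2.1))))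
      ((Measure.pi fun w : {w : {w : InfinitePlace L // IsComplex w} // w ∈ S'} =>
          quotientMeasure (chartTorusGLoc L α w.1 S') (t w.1) (isClosed_chartTorusGLoc L α w.1 S') (ν'w w.1)).prod
        ((quotientMeasure (chartTorusGLoc L α w₀ S') (t w₀) (isClosed_chartTorusGLoc L α w₀ S') (ν'w w₀)).prod
          (quotientMeasure (Subgroup.pi Set.univ (fun w : {w : {w : {w : InfinitePlace L // IsComplex w} // w ∉ S'} // w.1 ≠ w₀} => chartTorusGLoc L α w.1.1 S')) ρrest
            (isClosed_coe_pi _ fun w => isClosed_chartTorusGLoc L α w.1.1 S')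
            (Measure.pi fun w : {w : {w : {w : InfinitePlace L // IsComplex w} // w ∉ S'} // w.1 ≠ w₀} => ν'w w.1.1)))) := by
  haveI : ∀ w : {w : InfinitePlace L // IsComplex w}, SecondCountableTopology (↥(archLocal L 3 (Matrix.diagonal α) w) ⧸ chartTorusGLoc L α w S') := fun w => inferInstance
  haveI : ∀ w : {w : InfinitePlace L // IsComplex w},
      SigmaFinite (quotientMeasure (chartTorusGLoc L α w S') (t w) (isClosed_chartTorusGLoc L α w S') (ν'w w)) := fun w => inferInstance
  obtain ⟨Φ, hΦ, hΦx⟩ := exists_measurableEquiv_heldOut L α S' ν'w t hw₀ ρrest hρ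
  rw [← hΦ.integrable_comp_emb Φ.measurableEmbedding]
  -- in the (A1) §2 coordinates the composite IS the all-places integrand, integrable by ★ (A1) §4
  have hmp := (measurePreserving_piEquivPiSubtypeProd'
    (fun w : {w : InfinitePlace L // IsComplex w} => quotientMeasure (chartTorusGLoc L α w S') (t w) (isClosed_chartTorusGLoc L α w S') (ν'w w))
    (fun w => w ∈ S')).symm
    (MeasurableEquiv.piEquivPiSubtypeProd (fun w : {w : InfinitePlace L // IsComplex w} => ↥(archLocal L 3 (Matrix.diagonal α) w) ⧸ chartTorusGLoc L α w S')
      (fun w => w ∈ S'))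
  have hint := (hmp.integrable_comp_emb (MeasurableEquiv.measurableEmbedding _)).2
    (integrable_comp_symm_archPiEquivCM_descConj_pi_of_regG L α S' ν'w ν' hν t hα hS' hc ha'c ha's)
  refine hint.congr (Filter.Eventually.of_forall fun x => ?_)
  obtain ⟨x₁, x₂⟩ := x
  obtain ⟨h1, h2, h3⟩ := hΦx (x₁, x₂)
  simp only [Function.comp_apply]
  rw [h1, h2, h3, ← heldOut_point_eq L α S' hw₀ c x₁ x₂]
  rfl

include hν hρ hw₀ in
/-- **(A1′) ITERATED — `w₀` OUTSIDE** (Fubini on §1 after moving the `w₀`-factor to the front, §0; integrability from `integrable_heldOut_of_regG`): for admissible `S′`, `c ∈ RegG S′`,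
`a′ ∈ C_c(G′_∞)`,
`chartOrbG ν′ S′ a′ c = (∏_w t_w(B′_w)) · ∫_{U_{w₀}⧸T′_{w₀}} ( ∫_{(Π_{S′} U⧸T′) × X_rest} a′ (e⁻¹ (update (…) w₀ (x₀ γ_{w₀}(c) x₀⁻¹))) d((⊗_{S′} q_w) ⊗ Q_rest) ) dq_{w₀}(x₀)` — the one-place
orbital integral at `w₀` of a function of `x₀ γ_{w₀}(c) x₀⁻¹ ∈ U_{w₀}`. [cite: Rogawski1990, §8.2 p. 122; §8.3 pp. 122–124] [cite: Folland1995, §2.6 (2.52)] [cite: DeitmarEchterhoff2014, Lemma 9.3.3] -/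
theorem chartOrbG_eq_prod_mul_integral_integral_heldOut_of_regG (hα : ∀ i, α i ≠ 0) (hS' : ∀ w, w ∈ S' → w ∈ splitChartPlaces L α)
    {c : {w : InfinitePlace L // IsComplex w} → Fin 3 → ℝ} (hc : c ∈ RegG S')
    {a' : ↥(arch (↥(maximalRealSubfield L)) L (IsCMField.complexConj L) 3 (Matrix.diagonal α)) → ℂ} (ha'c : Continuous a') (ha's : HasCompactSupport a') :
    chartOrbG L α ν' S' a' c =
      (∏ w, ((t w (chartBoxImgGLoc L α w S')).toReal : ℂ)) *
        ∫ x₀ : ↥(archLocal L 3 (Matrix.diagonal α) w₀) ⧸ chartTorusGLoc L α w₀ S',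
          (∫ p : (∀ w : {w : {w : InfinitePlace L // IsComplex w} // w ∈ S'}, ↥(archLocal L 3 (Matrix.diagonal α) w.1) ⧸ chartTorusGLoc L α w.1 S') ×
              ((∀ w : {w : {w : {w : InfinitePlace L // IsComplex w} // w ∉ S'} // w.1 ≠ w₀}, ↥(archLocal L 3 (Matrix.diagonal α) w.1.1)) ⧸
            Subgroup.pi Set.univ (fun w : {w : {w : {w : InfinitePlace L // IsComplex w} // w ∉ S'} // w.1 ≠ w₀} => chartTorusGLoc L α w.1.1 S')),
            a' ((archPiEquivCM 3 L (Matrix.diagonal α)).symm (Function.update (fun w =>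
              if h : w ∈ S' then
                descConj (gprimeBlockAt L α w S' (c w)) (chartTorusGLoc L α w S') (forall_mem_chartTorusGLoc_comm L α w S' (c w)) id (p.1 ⟨w, h⟩)
              else if h₀ : w = w₀ then 1
              else
                descConj (fun w : {w : {w : {w : InfinitePlace L // IsComplex w} // w ∉ S'} // w.1 ≠ w₀} => gprimeBlock L α w.1.1 S' c)
                  (Subgroup.pi Set.univ (fun w : {w : {w : {w : InfinitePlace L // IsComplex w} // w ∉ S'} // w.1 ≠ w₀} => chartTorusGLoc L α w.1.1 S'))
                  (forall_mem_pi_chartTorusGLoc_comm L α S' (fun w : {w : {w : {w : InfinitePlace L // IsComplex w} // w ∉ S'} // w.1 ≠ w₀} => w.1.1) c)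
                  (fun g => (g ⟨⟨w, h⟩, h₀⟩ : ↥(archLocal L 3 (Matrix.diagonal α) w))) p.2)
            w₀ (descConj (gprimeBlockAt L α w₀ S' (c w₀)) (chartTorusGLoc L α w₀ S') (forall_mem_chartTorusGLoc_comm L α w₀ S' (c w₀)) id x₀)))
            ∂((Measure.pi fun w : {w : {w : InfinitePlace L // IsComplex w} // w ∈ S'} =>
                quotientMeasure (chartTorusGLoc L α w.1 S') (t w.1) (isClosed_chartTorusGLoc L α w.1 S') (ν'w w.1)).prod
              (quotientMeasure (Subgroup.pi Set.univ (fun w : {w : {w : {w : InfinitePlace L // IsComplex w} // w ∉ S'} // w.1 ≠ w₀} => chartTorusGLoc L α w.1.1 S')) ρrest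
            (isClosed_coe_pi _ fun w => isClosed_chartTorusGLoc L α w.1.1 S')
            (Measure.pi fun w : {w : {w : {w : InfinitePlace L // IsComplex w} // w ∉ S'} // w.1 ≠ w₀} => ν'w w.1.1))))
          ∂(quotientMeasure (chartTorusGLoc L α w₀ S') (t w₀) (isClosed_chartTorusGLoc L α w₀ S') (ν'w w₀)) := by
  haveI : ∀ w : {w : InfinitePlace L // IsComplex w}, SecondCountableTopology (↥(archLocal L 3 (Matrix.diagonal α) w) ⧸ chartTorusGLoc L α w S') := fun w => inferInstance
  haveI : ∀ w : {w : InfinitePlace L // IsComplex w},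
      SigmaFinite (quotientMeasure (chartTorusGLoc L α w S') (t w) (isClosed_chartTorusGLoc L α w S') (ν'w w)) := fun w => inferInstance
  have hMc : IsClosed ((Subgroup.pi Set.univ (fun w : {w : {w : {w : InfinitePlace L // IsComplex w} // w ∉ S'} // w.1 ≠ w₀} => chartTorusGLoc L α w.1.1 S')) :
      Set (∀ w : {w : {w : {w : InfinitePlace L // IsComplex w} // w ∉ S'} // w.1 ≠ w₀}, ↥(archLocal L 3 (Matrix.diagonal α) w.1.1))) :=
    isClosed_coe_pi _ fun w => isClosed_chartTorusGLoc L α w.1.1 S'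
  haveI : LocallyCompactSpace ↥(Subgroup.pi Set.univ (fun w : {w : {w : {w : InfinitePlace L // IsComplex w} // w ∉ S'} // w.1 ≠ w₀} => chartTorusGLoc L α w.1.1 S')) :=
    hMc.isClosedEmbedding_subtypeVal.locallyCompactSpace
  haveI : SecondCountableTopology ↥(Subgroup.pi Set.univ (fun w : {w : {w : {w : InfinitePlace L // IsComplex w} // w ∉ S'} // w.1 ≠ w₀} => chartTorusGLoc L α w.1.1 S')) :=
    TopologicalSpace.Subtype.secondCountableTopology _
  haveI : SFinite ρrest := inferInstance
  rw [chartOrbG_eq_prod_mul_integral_pi_prod_heldOut L α S' ν'w ν' hν t hw₀ ρrest hρ hα hS' a' c, integral_prod_prodLeftComm]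
  congr 1
  rw [integral_prod _ ((integrable_prodLeftComm_iff _ _ _ _).2
    (integrable_heldOut_of_regG L α S' ν'w ν' hν t hw₀ ρrest hρ hα hS' hc ha'c ha's))]

end HeldOut
end Literature.NumberTheory.Automorphic.UnitaryGroup
end
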